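import Literature.AlgebraicGeometry.Resolution.AlterationsSemiStable
import HarnessLib

/-!
# De Jong's alteration theorem: 4.23–4.28 split at Situation 4.25 (the formal normal forms)

Topic: `Literature/AlgebraicGeometry/Resolution`. Companion to `AlterationsSemiStable.lean`, which
cuts the step 4.11–4.28 of the printed proof of de Jong 1996, Thm. 4.1 at Situation 4.23 into
`DeJong1996ReductionToSemiStablePair` (4.11–4.22) and `DeJong1996SemiStablePairResolution`
(4.23–4.28). This file cuts the second of these once more, where the text restarts again:

> "4.24. Using the modification of Lemma 3.2 we reduce to the situation 4.23, where we have in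
> addition that `codim(Sing(X), X) ≥ 3`. … The situation is further explained in 3.5. Using
> these explanations we see that we reduce to the situation described in 4.25 below. (Note
> that there we consider only closed points, so that the situation is automatically split.)
> **4.25. Situation.** Here `X` is a projective variety of dimension `d` over an algebraically
> closed field `k`. We have a divisor `Z ⊂ X`. Let `x ∈ X(k)` be an arbitrary closed point;
> either of the following two conditions holds: (i) `x` is a nonsingular point of `X`. In this
> case `Z` is a normal crossings divisor at `x` (or `x ∉ Z`). (ii) `x` is a singular point of
> `X`. In this case there are integers `2 ≤ s ≤ r ≤ d - 1` such that the completion of the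
> local ring `𝒪_{X,x}` is isomorphic to `k⟦u, v, t₁, …, t_{d-1}⟧/(uv - t₁ ⋯ t_s)` and `Z` is
> defined by `t₁ ⋯ t_r = 0`. Finally, the components of the singular locus of `X` are
> nonsingular." (p. 75)

Before: 4.24, i.e. §3 — Lemma 3.2 (a projective modification with centre in `Sing(X)` making
`codim Sing(X) ≥ 3` while keeping a semi-stable curve smooth off `D`) and the local analysis
3.3–3.5 of a semi-stable curve over a regular base degenerating over a strict normal crossings
divisor. After: 4.26–4.28 — blowing up the (nonsingular) irreducible components of `Sing(X)`
one at a time (Claim 4.27, by the explicit charts) until `X` is nonsingular and `Z` has normal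
crossings, then blowing up further to make the crossings strict (2.4). Accordingly this file

* defines the **formal models**
  `DeJong1996.NodalFamilyRing k m s = k⟦u, v, t₁, …, t_m⟧/(uv - t₁ ⋯ t_s)` with its boundary
  equation `t₁ ⋯ t_r` (`nodalFamilyBoundary`), the normal crossings equation
  `x₁ ⋯ x_r ∈ k⟦x₁, …, x_d⟧` (`normalCrossingsEquation`), and the completed stalk of an ideal
  sheaf `completedStalkIdeal I x U hU ⊆ 𝒪̂_{X,x}` (Mathlib's `AdicCompletion` of `𝒪_{X,x}` at
  `𝔪ₓ`);
* defines **Situation 4.25**, `DeJong1996.NormalFormPair f Z d`, in FORMAL-LOCAL form: the two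
  printed conditions are conditions on the complete local rings of `X` at closed points together
  with the completed ideal of the reduced closed subscheme `Z` ("normal crossings at `x`" of 2.4
  is étale-local; for the reduced divisor `Z` on the variety `X` the formal and the étale-local
  forms agree by Artin approximation — this equivalence is used implicitly by the text, whose
  4.27 is checked on complete local rings), plus "`Z` is a divisor" (2.3) and "the components of
  `Sing(X)` are nonsingular" (the reduced closed subschemes on the irreducible components of the
  non-regular locus are regular schemes); proved API: `X → Spec k` proper, `Z ≠ X`, and a pair
  in Situation 4.25 is a pair as in Thm. 4.1;
* vendors NAMED FACTS `DeJong1996SemiStablePairNormalForm` (4.24 with Lemma 3.2, 3.5) and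
  `DeJong1996NormalFormPairResolution` (4.25–4.28 with 2.4);
* PROVES the assembly `DeJong1996SemiStablePairResolution.of_normalForm`, the three-block
  assembly `DeJong1996NormalProjectiveStep.of_semiStablePair_of_normalForm`, and the sanity
  implications `DeJong1996SemiStablePairResolution → DeJong1996SemiStablePairNormalForm`,
  `DeJong1996StrongAlgClosed → DeJong1996NormalFormPairResolution`.

The indices in 4.25 (ii) are those of 3.5 ("`B` looks like `A'⟦u, v⟧/(Q - t₁ ⋯ t_s)` for some
`2 ≤ s ≤ r` and `D` at `s` is defined by `t₁ ⋯ t_r = 0`", `t₁, …, t_{d-1}` regular parameters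
of the base at `f(x)`): the discriminant `t₁ ⋯ t_s` of the node divides the equation `t₁ ⋯ t_r`
of `Z = f⁻¹(D)` near a singular point, and `s ≥ 2` since for `s = 1` the point is regular.

## Sources

* A. J. de Jong, *Smoothness, semi-stability and alterations*, Publ. Math. IHÉS 83 (1996) 51–93:
  2.2–2.4 (p. 55), 3.1–3.5 and Lemma 3.2 (pp. 62–64), 4.23–4.28 (pp. 75–76).
-/

noncomputable section

open CategoryTheory CategoryTheory.Limits AlgebraicGeometry TopologicalSpace Topology

namespace Literature.AlgebraicGeometry.Resolution

universe u

open IsLocalRing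

/-! ## The formal models of Situation 4.25 -/

namespace DeJong1996

/-- The defining relation `uv - t₁ ⋯ t_s` of the formal model of a singular point in Situation
4.25, in `k⟦u, v, t₁, …, t_m⟧ = MvPowerSeries (Fin 2 ⊕ Fin m) k` (`u = inl 0`, `v = inl 1`,
`tᵢ = inr (i - 1)`). [cite: DeJong1996, 4.25 (ii), p. 75] -/
def nodalFamilyRelation (k : Type u) [Field k] (m s : ℕ) : MvPowerSeries (Fin 2 ⊕ Fin m) k :=
  MvPowerSeries.X (Sum.inl 0) * MvPowerSeries.X (Sum.inl 1) -
    ∏ i ∈ Finset.univ.filter (fun i : Fin m => i.val < s), MvPowerSeries.X (Sum.inr i)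

/-- The formal model `k⟦u, v, t₁, …, t_m⟧/(uv - t₁ ⋯ t_s)` of a singular point in Situation
4.25 (de Jong 1996, 3.5 and 4.25 (ii), with `m = d - 1`). [cite: DeJong1996, 4.25 (ii), p. 75] -/
abbrev NodalFamilyRing (k : Type u) [Field k] (m s : ℕ) : Type u :=
  MvPowerSeries (Fin 2 ⊕ Fin m) k ⧸ Ideal.span {nodalFamilyRelation k m s}

/-- The equation `t₁ ⋯ t_r` of the boundary in the formal model of a singular point.
[cite: DeJong1996, 4.25 (ii), p. 75] -/
def nodalFamilyBoundary (k : Type u) [Field k] (m s r : ℕ) : NodalFamilyRing k m s :=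
  Ideal.Quotient.mk _ (∏ i ∈ Finset.univ.filter (fun i : Fin m => i.val < r),
    MvPowerSeries.X (Sum.inr i))

/-- The equation `x₁ ⋯ x_r` of a normal crossings divisor in the formal model `k⟦x₁, …, x_d⟧`
of a nonsingular point. [cite: DeJong1996, 2.4 and 4.25 (i), pp. 55, 75] -/
def normalCrossingsEquation (k : Type u) [Field k] (d r : ℕ) : MvPowerSeries (Fin d) k :=
  ∏ i ∈ Finset.univ.filter (fun i : Fin d => i.val < r), MvPowerSeries.X i

end DeJong1996

/-- The ideal generated in the `𝔪ₓ`-adic completion `𝒪̂_{X,x}` of the local ring at `x` by (the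
stalk at `x` of) an ideal sheaf `I`, computed on an affine open neighbourhood `U` of `x` as the
extension of `I(U)` along `Γ(X, U) → 𝒪_{X,x} → 𝒪̂_{X,x}` (independent of `U`, cf.
`IsStrictNormalCrossingsDivisor`). [folklore] -/
def completedStalkIdeal {X : Scheme.{u}} (I : X.IdealSheafData) (x : X) (U : X.affineOpens)
    (hU : x ∈ (U : X.Opens)) :
    Ideal (AdicCompletion (maximalIdeal (X.presheaf.stalk x)) (X.presheaf.stalk x)) :=
  ((I.ideal U).map (X.presheaf.germ U x hU).hom).map
    (algebraMap (X.presheaf.stalk x) (AdicCompletion (maximalIdeal (X.presheaf.stalk x))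
      (X.presheaf.stalk x)))

/-! ## Situation 4.25 -/

namespace DeJong1996

open Scheme.IdealSheafData in
/-- **de Jong 1996, Situation 4.25** for the pair `(X, Z)`: "Here `X` is a projective variety of
dimension `d` over an algebraically closed field `k`. We have a divisor `Z ⊂ X`. Let `x ∈ X(k)`
be an arbitrary closed point; either of the following two conditions holds: (i) `x` is a
nonsingular point of `X`. In this case `Z` is a normal crossings divisor at `x` (or `x ∉ Z`).
(ii) `x` is a singular point of `X`. In this case there are integers `2 ≤ s ≤ r ≤ d - 1` such
that the completion of the local ring `𝒪_{X,x}` is isomorphic to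
`k⟦u, v, t₁, …, t_{d-1}⟧/(uv - t₁ ⋯ t_s)` and `Z` is defined by `t₁ ⋯ t_r = 0`. Finally, the
components of the singular locus of `X` are nonsingular." (3.5: `2 ≤ s ≤ r`, `D` at `f(x)`
being `t₁ ⋯ t_r = 0` for the regular parameters `t₁, …, t_{d-1}` of `Y` at `f(x)`.) Rendered:
`X` integral, projective over `k`, `dim X = d`; `Z` closed, the support of an effective Cartier
divisor (2.3, `IsEffectiveCartier`); for every closed point `x` with `𝒪_{X,x}` regular
("nonsingular", `k` being algebraically closed) and `x ∈ Z` there are `1 ≤ r ≤ d` and an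
isomorphism of the completion `𝒪̂_{X,x}` (Mathlib's `AdicCompletion` at `𝔪ₓ`) with
`k⟦x₁, …, x_d⟧` carrying the completed ideal of `Z` (reduced structure, 2.2: the vanishing ideal
sheaf of `Z`; `completedStalkIdeal`) to `(x₁ ⋯ x_r)` — "normal crossings at `x`" in its formal
form, which for the reduced divisor `Z` on the variety `X` is equivalent to the étale-local
form of 2.4 (Artin approximation); for every closed point `x` with `𝒪_{X,x}` not regular there
are `2 ≤ s ≤ r ≤ d - 1` and an isomorphism `𝒪̂_{X,x} ≅ k⟦u, v, t₁, …, t_{d-1}⟧/(uv - t₁ ⋯ t_s)`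
(`NodalFamilyRing k (d - 1) s`) carrying the completed ideal of `Z` to `(t₁ ⋯ t_r)`
(`nodalFamilyBoundary`); the singular locus `{x | 𝒪_{X,x} not regular}` is closed and each of
its irreducible components, with its reduced closed subscheme structure, is a regular scheme.
[cite: DeJong1996, 4.25, p. 75] -/
structure NormalFormPair {k : Type u} [Field k] {X : Scheme.{u}} (f : X ⟶ Spec (.of k))
    (Z : Set X) (d : ℕ) : Prop where
  /-- `X` is integral (a variety, 2.9) -/
  isIntegral : IsIntegral X
  /-- `X` is projective over `k` -/
  isProjectiveOver : Literature.AlgebraicGeometry.Motives.IsProjectiveOver (Over.mk f)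
  /-- `dim X = d` -/
  topologicalKrullDim_eq : topologicalKrullDim X = d
  /-- `Z` is closed -/
  isClosed : IsClosed Z
  /-- `Z` is (the support of) a divisor (2.3: an effective Cartier divisor) -/
  exists_isEffectiveCartier :
    ∃ I : X.IdealSheafData, IsEffectiveCartier I ∧ (I.support : Set X) = Z
  /-- (i) at a nonsingular closed point of `Z`, `Z` has normal crossings (formally):
  `(𝒪̂_{X,x}, Î_Z) ≅ (k⟦x₁, …, x_d⟧, (x₁ ⋯ x_r))`, `1 ≤ r ≤ d` -/
  exists_ringEquiv_of_isRegularLocalRing : ∀ x : X, IsClosed ({x} : Set X) →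
    IsRegularLocalRing (X.presheaf.stalk x) → x ∈ Z →
      ∃ r : ℕ, 1 ≤ r ∧ r ≤ d ∧
        ∃ e : AdicCompletion (maximalIdeal (X.presheaf.stalk x)) (X.presheaf.stalk x) ≃+*
            MvPowerSeries (Fin d) k,
          ∀ (U : X.affineOpens) (hU : x ∈ (U : X.Opens)),
            (completedStalkIdeal (vanishingIdeal ⟨Z, isClosed⟩) x U hU).map e.toRingHom =
              Ideal.span {normalCrossingsEquation k d r}
  /-- (ii) at a singular closed point, `(𝒪̂_{X,x}, Î_Z) ≅ (k⟦u, v, t₁, …, t_{d-1}⟧/(uv - t₁ ⋯ t_s),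
  (t₁ ⋯ t_r))` with `2 ≤ s ≤ r ≤ d - 1` -/
  exists_ringEquiv_of_not_isRegularLocalRing : ∀ x : X, IsClosed ({x} : Set X) →
    ¬ IsRegularLocalRing (X.presheaf.stalk x) →
      ∃ s r : ℕ, 2 ≤ s ∧ s ≤ r ∧ r ≤ d - 1 ∧
        ∃ e : AdicCompletion (maximalIdeal (X.presheaf.stalk x)) (X.presheaf.stalk x) ≃+*
            NodalFamilyRing k (d - 1) s,
          ∀ (U : X.affineOpens) (hU : x ∈ (U : X.Opens)),
            (completedStalkIdeal (vanishingIdeal ⟨Z, isClosed⟩) x U hU).map e.toRingHom =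
              Ideal.span {nodalFamilyBoundary k (d - 1) s r}
  /-- the singular locus of `X` is closed -/
  isClosed_setOf_not_isRegularLocalRing :
    IsClosed {x : X | ¬ IsRegularLocalRing (X.presheaf.stalk x)}
  /-- the irreducible components of the singular locus of `X` (with their reduced closed
  subscheme structure) are nonsingular -/
  isRegular_subscheme : ∀ E ∈ irreducibleComponents
      ↥({x : X | ¬ IsRegularLocalRing (X.presheaf.stalk x)} : Set X),
    Scheme.IsRegular
      (vanishingIdeal ⟨closure (Subtype.val '' E), isClosed_closure⟩).subscheme

namespace NormalFormPair

variable {k : Type u} [Field k] {X : Scheme.{u}} {f : X ⟶ Spec (.of k)} {Z : Set X} {d : ℕ}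

/-- In Situation 4.25, `X → Spec k` is proper. [folklore] -/
theorem isProper (h : NormalFormPair f Z d) : IsProper f :=
  Literature.AlgebraicGeometry.Motives.IsProjectiveOver.isProper (X := Over.mk f)
    h.isProjectiveOver

/-- In Situation 4.25, `X → Spec k` is separated. [folklore] -/
theorem isSeparated (h : NormalFormPair f Z d) : IsSeparated f :=
  haveI := h.isProper
  inferInstance

/-- In Situation 4.25, `X → Spec k` is locally of finite type. [folklore] -/
theorem locallyOfFiniteType (h : NormalFormPair f Z d) : LocallyOfFiniteType f :=
  haveI := h.isProper
  inferInstance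

/-- In Situation 4.25, `X → Spec k` is quasi-compact. [folklore] -/
theorem quasiCompact (h : NormalFormPair f Z d) : QuasiCompact f :=
  haveI := h.isProper
  inferInstance

/-- In Situation 4.25, `Z ≠ X` (the support of a divisor on a variety misses the generic
point). [folklore] -/
theorem ne_univ (h : NormalFormPair f Z d) : Z ≠ Set.univ := by
  haveI := h.isIntegral
  obtain ⟨I, hI, hIZ⟩ := h.exists_isEffectiveCartier
  intro hZ
  have := NormalProjectivePair.genericPoint_notMem_support hI
  rw [hIZ, hZ] at this
  exact this (Set.mem_univ _)

/-- Sanity of the cut: a pair in Situation 4.25 is a pair as in Thm. 4.1, so Thm. 4.1 with its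
generically-étale clause over algebraically closed fields serves it. [folklore] -/
theorem conclusionGenericallyEtale_of_strongAlgClosed [IsAlgClosed k] (h : NormalFormPair f Z d)
    (H : DeJong1996StrongAlgClosed.{u}) : ConclusionGenericallyEtale f Z :=
  H k X f Z h.isSeparated h.locallyOfFiniteType h.quasiCompact h.isIntegral h.isClosed h.ne_univ

end NormalFormPair

end DeJong1996

/-! ## 4.24 and 4.25–4.28 as named facts -/

/-- NAMED FACT — **de Jong 1996, 4.24 (with Lemma 3.2 and 3.5): from Situation 4.23 to
Situation 4.25.** Over an algebraically closed field `k`, Thm. 4.1 with its generically-étale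
clause for a pair `(X, Z)` in Situation 4.23 (`DeJong1996.SemiStablePair`,
`Z = ⋃ᵢ τᵢ(Y) ∪ f⁻¹(D)`) follows from Thm. 4.1 with the clause for every pair `(X', Z')` in
Situation 4.25 (`DeJong1996.NormalFormPair`) over `k` with `dim X' = dim X`: "4.24. Using the
modification of Lemma 3.2 [a projective modification `φ₁ : X₁ → X` with centre in `Sing(X)`,
`X₁` again a semi-stable curve over `Y` smooth over `Y ∖ D`, and `codim(Sing(X₁), X₁) ≥ 3`] we
reduce to the situation 4.23, where we have in addition that `codim(Sing(X), X) ≥ 3`. (Of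
course the sections `τᵢ` still map into the smooth locus of `f`; in fact, `Z` is already
everywhere a divisor with normal crossings, except in the singular points of `X`.
Furthermore, it is a divisor, as `D` is a divisor and `τᵢ(Y)` is a divisor.) The situation is
further explained in 3.5 [the complete local rings `A'⟦u, v⟧/(Q - t₁ ⋯ t_s)`, `2 ≤ s ≤ r`, `D`
given by `t₁ ⋯ t_r = 0`; the components of `Sing(X)` are finite étale over components of
`Dᵢ ∩ Dⱼ`, hence regular]. Using these explanations we see that we reduce to the situation
described in 4.25 below. (Note that there we consider only closed points, so that the
situation is automatically split.)" The reduction is along a modification (a generically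
étale alteration, 4.4), which preserves the dimension. Users take
`(h : DeJong1996SemiStablePairNormalForm)`; it is the node carrying §3.
[cite: DeJong1996, 4.24, p. 75] -/
def DeJong1996SemiStablePairNormalForm : Prop :=
  ∀ (k : Type u) [Field k] [IsAlgClosed k] (X Y : Scheme.{u}) (f : X ⟶ Y)
    (g : Y ⟶ Spec (.of k)) (D : Set Y) (n : ℕ) (τ : Fin n → (Y ⟶ X)),
    DeJong1996.SemiStablePair f g D τ →
      (∀ (X' : Scheme.{u}) (f' : X' ⟶ Spec (.of k)) (Z' : Set X') (d : ℕ),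
          DeJong1996.NormalFormPair f' Z' d → topologicalKrullDim X' = topologicalKrullDim X →
            DeJong1996.ConclusionGenericallyEtale f' Z') →
        DeJong1996.ConclusionGenericallyEtale (f ≫ g) (DeJong1996.semiStableBoundary f D τ)

/-- NAMED FACT — **de Jong 1996, 4.25–4.28: resolution of a pair in Situation 4.25 by blowing
up the singular components.** Over an algebraically closed field `k`, Thm. 4.1 with its
generically-étale clause holds for every pair `(X, Z)` in Situation 4.25
(`DeJong1996.NormalFormPair f Z d`): "4.26. Assume `(X, Z)` as in 4.25. Let `E ⊂ X` be an
irreducible component of `Sing(X)`. Let `π : X' → X` be the blowing up of `X` in the ideal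
sheaf of `E`, and put `Z' = π⁻¹(Z)_{red}`. 4.27. Claim. The pair `(X', Z')` is as described in
4.25. The number of components of `Sing(X')` is one less than the number of components of
`Sing(X)`. [Proof by the explicit charts of the blow-up of `k[u, v, t₁, …, t_{d-1}]/(uv - t₁ ⋯ t_s)`
in `(u, v, t₁, t₂)`.] 4.28. By repeatedly blowing up `(X, Z)` as in 4.26 we finally get the
situation that `X` is nonsingular and `Z` is a normal crossings divisor. It is well known that
by blowing up `X` further we can reach the situation where `Z` has strict normal crossings,
see 2.4. This finishes the proof of Theorem 4.1." (The solution is a composition of blow-ups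
`φ₁ : X₁ → X` of the projective `X` — a modification, hence a generically étale alteration —
with `X̄₁ = X₁`, `j₁ = 𝟙`.) Users take `(h : DeJong1996NormalFormPairResolution)`.
[cite: DeJong1996, 4.25–4.28, pp. 75–76] -/
def DeJong1996NormalFormPairResolution : Prop :=
  ∀ (k : Type u) [Field k] [IsAlgClosed k] (X : Scheme.{u}) (f : X ⟶ Spec (.of k)) (Z : Set X)
    (d : ℕ), DeJong1996.NormalFormPair f Z d → DeJong1996.ConclusionGenericallyEtale f Z

/-! ## The assembly -/

/-- **4.23–4.28 from its two printed parts**: 4.24 (`DeJong1996SemiStablePairNormalForm`) and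
4.25–4.28 (`DeJong1996NormalFormPairResolution`) give `DeJong1996SemiStablePairResolution`.
[cite: DeJong1996, 4.23–4.28, pp. 75–76] -/
theorem DeJong1996SemiStablePairResolution.of_normalForm
    (h₁ : DeJong1996SemiStablePairNormalForm.{u}) (h₂ : DeJong1996NormalFormPairResolution.{u}) :
    DeJong1996SemiStablePairResolution.{u} :=
  fun k _ _ X Y f g D n τ hS =>
    h₁ k X Y f g D n τ hS fun X' f' Z' d hN _ => h₂ k X' f' Z' d hN

/-- Sanity of the cut: 4.24 is implied by 4.23–4.28. [folklore] -/
theorem DeJong1996SemiStablePairNormalForm.of_semiStablePairResolution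
    (h : DeJong1996SemiStablePairResolution.{u}) : DeJong1996SemiStablePairNormalForm.{u} :=
  fun k _ _ X Y f g D n τ hS _ => h k X Y f g D n τ hS

/-- Sanity of the cut: 4.25–4.28 is implied by Thm. 4.1 over algebraically closed fields.
[folklore] -/
theorem DeJong1996NormalFormPairResolution.of_strongAlgClosed (H : DeJong1996StrongAlgClosed.{u}) :
    DeJong1996NormalFormPairResolution.{u} :=
  fun _k _ _ _X _f _Z _d hN => hN.conclusionGenericallyEtale_of_strongAlgClosed H

/-- The step 4.11–4.28 from the three vendored blocks 4.11–4.22, 4.24, 4.25–4.28.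
[cite: DeJong1996, 4.11–4.28, pp. 67–76] -/
theorem DeJong1996NormalProjectiveStep.of_semiStablePair_of_normalForm
    (h₁ : DeJong1996ReductionToSemiStablePair.{u}) (h₂ : DeJong1996SemiStablePairNormalForm.{u})
    (h₃ : DeJong1996NormalFormPairResolution.{u}) : DeJong1996NormalProjectiveStep.{u} :=
  DeJong1996NormalProjectiveStep.of_semiStablePair h₁
    (DeJong1996SemiStablePairResolution.of_normalForm h₂ h₃)

end Literature.AlgebraicGeometry.Resolution

end
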